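import Summits.Ventures.HSemireg.Pad4TowerXresFamilies
import Summits.Ventures.HSemireg.Pad4TowerLineLetters

/-!
# Pad4Tower ∕ LineInertia toolkit (1∕2): effective LINE letters and supports, the ray classification on the LINE, and the three
# closed forms of RULE D (μ₄, M) on the LINE alphabet `α + c = h` (HSemireg support file; PT-PORT-2 (a1), tree copy of control's toolkit)

Crux of record: `Summit.HodgeConjecture.HodgeConjecture.Theses.EightfoldBlochSeeds.BlochSeedDiscOne` (= `HasHyperbolicBlochSeed 4 1`, item
stmt-HodgeConjecture-18881; skeleton `Cruxes/BlochSeedDiscOne/Lines/birth.lean` 814a6a70c14e831a, STUB R `stub_rung_pad4_seedAt`, UNTOUCHED).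
Nothing in this file proves HC, HC_AV, HC_CM, H2 or item 18881; census-neutral (no SAT∕UNSAT row is added or changed). It is LETTER ALGEBRA on
the LINE alphabet of the PAD-4 static game — statements about the typed first-order families of record (`Pad4TowerRuleDMu4.RuleDMu4P∕N`,
`Pad4TowerXresFamilies`), not about sheaves, monads or seeds.

PROVENANCE. TREE COPY (statements AND proofs verbatim; only the namespace, this docstring and the module boundary are new) of §1–§3 of the
crux workfile `Cruxes/BlochSeedDiscOne/LineInertia.lean` v6 (author plan-lens-HodgeAV-control g8; crux commit 06a81ba2af55, sha16 3b0837875d3109fc;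
critic plates idea-crit-6 g13∕g14 PASS) = Part A §1–§3 of `Cruxes/BlochSeedDiscOne/LinePhaseRigidity.lean` v1.9 (control g9; f0ad6d2122a71d9c), which
carried a «verbatim local copy … Cruxes modules are not importable». Filed in the tree on plan-lens-HodgeAV-control g10's KEY (a1) (bus l.10147,
«PT-PORT-2 … the shared toolkit → tree module(s) … so the crux files import instead of copying») by hsemireg-phasetorus-typer-1 g3. §4 (`X+` fires)
and the census glue `lsupport_of_diamond_ceiling` are in `Pad4TowerLineInertiaXPlus`.

CONTENT. §1 `IsLL h x` (effective LINE-`h` letter `lineLetter h c k = (h − c)·I + c·ℓ_{i^k}`, `2c ≤ h`), `LSupport h C`; the letter facts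
`lineLetter_zero ∕ isApex_lineLetter_iff ∕ adapted_lineLetter ∕ coord_lineLetter ∕ lineLetter_fst ∕ isLL_of_lineCell`. §2 THE RAY CLASSIFICATION
`up_classify` (up from a charged LINE letter only along its own ray towards `hI`; 64 cases, `omega`), `of_dual_ray`, `dual_lineLetter`, `add_two_ne`,
`add_one_ne`. §3 RULE D on the LINE, closed forms: (RD-P) `p_up_server` (a RULE-D `P`-cell is served above along each charged letter's own ray),
(RD-N) `n_down_server`, `n_hub_alternative`. Imports: tree `Pad4TowerXresFamilies` + `Pad4TowerLineLetters` only (as the workfile). 0 sorry,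
0 named facts, no instance ∕ notation ∕ set_option; docstring on every declaration.
-/

namespace Summit.Ventures.HSemireg.Pad4Tower.LineInertia

open Finset Summit.Ventures.HSemireg.Pad4Tower Summit.Ventures.HSemireg.LinePhaseTorus

/-! ## §1 Effective LINE letters and LINE supports -/

/-- `x` is an EFFECTIVE LINE-`h` LETTER: `x = lineLetter h c k = ((h − c)·I + c·ℓ_{i^k})` with `2c ≤ h` (effective from `O`). -/
abbrev IsLL (h : ℤ) (x : BPoint) : Prop := ∃ c : ℕ, ∃ k : Fin 4, 2 * (c : ℤ) ≤ h ∧ x = lineLetter h c k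

/-- an EFFECTIVE LINE-`h` SUPPORT: every letter of every cell, on both levels, is an effective LINE-`h` letter. -/
abbrev LSupport (h : ℤ) (C : MConfig) : Prop :=
  (∀ Z ∈ C.lower, ∀ f, IsLL h (Z f)) ∧ (∀ P ∈ C.upper, ∀ f, IsLL h (P f))

/-- the charge-`0` letter is the apex `hI`, whatever the phase tag. -/
theorem lineLetter_zero (h : ℤ) (k : Fin 4) : lineLetter h 0 k = (h, 0, 0) := by
  simp [lineLetter]

/-- a LINE letter is an apex point iff its charge is `0`. -/
theorem isApex_lineLetter_iff (h : ℤ) (c : ℕ) (k : Fin 4) : isApex (lineLetter h c k) ↔ c = 0 := by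
  fin_cases k <;> simp [lineLetter, isApex]

/-- a LINE letter of phase `k` is adapted to its own direction `k` and to the antipode `k + 2`. -/
theorem adapted_lineLetter (h : ℤ) (c : ℕ) (k : Fin 4) :
    Adapted (lineLetter h c k) k ∧ Adapted (lineLetter h c k) (k + 2) := by
  fin_cases k <;> simp [lineLetter, Adapted]

/-- its own coordinate is `h`, its antipodal coordinate is `h − 2c`. -/
theorem coord_lineLetter (h : ℤ) (c : ℕ) (k : Fin 4) :
    coord (lineLetter h c k) k = h ∧ coord (lineLetter h c k) (k + 2) = h - 2 * c := by
  fin_cases k <;> simp [lineLetter, coord] <;> ring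

/-- the `α`-part of a LINE letter. -/
theorem lineLetter_fst (h : ℤ) (c : ℕ) (k : Fin 4) : (lineLetter h c k).1 = h - c := by
  simp [lineLetter]

/-- from the tree's hypotheses: a LINE cell (`LinePhaseTorus.LineCell`) with letters effective from `O` has effective LINE letters. -/
theorem isLL_of_lineCell {h : ℤ} {Z : MCell} (hZ : LineCell h Z) (heff : ∀ f, Effective (Z f)) (f : Fin 4) : IsLL h (Z f) := by
  obtain ⟨c, k, e⟩ := hZ f
  refine ⟨c, k, ?_, e⟩
  have h1 := heff f
  rw [e] at h1
  rcases h1 with ⟨h0, h2⟩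
  have hc0 : (0 : ℤ) ≤ c := by exact_mod_cast Nat.zero_le c
  fin_cases k <;> simp [lineLetter] at h0 h2 <;> nlinarith

/-! ## §2 The ray classification on the LINE (letter algebra) -/

/-- THE RAY CLASSIFICATION: if the LINE letter `(c′, k′)` lies `d ≥ 1` null steps above the LINE letter `(c, k)` in direction `r`, then
`r` is the antipode `k + 2` of the lower letter's phase, the charge drops by exactly `d`, and the phase is kept unless the apex is reached.
(So: up from a charged LINE letter only along its own ray towards `hI`; down from `hI` in all four directions; down from a charged
letter only along its own ray.) [64 cases, `omega`] -/
theorem up_classify {h : ℤ} {c c' : ℕ} {k k' r : Fin 4} {d : ℤ} (hd : 1 ≤ d)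
    (e : lineLetter h c' k' = ray (lineLetter h c k) r d) : r = k + 2 ∧ (c : ℤ) = c' + d ∧ (c' = 0 ∨ k' = k) := by
  fin_cases k <;> fin_cases k' <;> fin_cases r <;> simp [lineLetter, ray, Prod.ext_iff] at e ⊢ <;> omega

/-- transport through the `X+` dual (`dualPt 0`: letters negated): `−y = (−x) + d·n_r` iff `x = y + d·n_r`. -/
theorem of_dual_ray {x y : BPoint} {r : Fin 4} {d : ℤ} (e : dualPt 0 y = ray (dualPt 0 x) r d) : x = ray y r d := by
  obtain ⟨a, b, c⟩ := x
  obtain ⟨a', b', c'⟩ := y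
  fin_cases r <;> simp [dualPt, ray, Prod.ext_iff] at e ⊢ <;> omega

/-- the negated LINE letter `(c, k)` is `c` null steps above the negated apex in direction `k + 2`. -/
theorem dual_lineLetter (h : ℤ) (c : ℕ) (k : Fin 4) :
    dualPt 0 (lineLetter h c k) = ray (dualPt 0 (h, 0, 0)) (k + 2) c := by
  fin_cases k <;> simp [dualPt, lineLetter, ray, Prod.ext_iff] <;> ring

/-- in `Fin 4`: `k + 2 ≠ k`. -/
theorem add_two_ne (k : Fin 4) : k + 2 ≠ k := by
  fin_cases k <;> decide

/-- in `Fin 4`: `k + 1 ≠ k`. -/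
theorem add_one_ne (k : Fin 4) : k + 1 ≠ k := by
  fin_cases k <;> decide

/-! ## §3 RULE D on the LINE: the three closed forms -/

/-- **(RD-P) a RULE-D `P`-cell is served above along each charged letter's own ray**: if `P g` is the charged LINE letter `(c, k)`,
some present `N`-cell is `P(g ↦ (c′, k))` with `c′ < c` (`c′ = 0` = the apex). -/
theorem p_up_server {h : ℤ} {C : MConfig} (hlow : ∀ N ∈ C.lower, ∀ f, IsLL h (N f)) {P : MCell} (hPL : ∀ f, IsLL h (P f))
    (hD : RuleDMu4P C P) {g : Fin 4} {c : ℕ} {k : Fin 4} (hg : P g = lineLetter h c k) (hc : 1 ≤ c) :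
    ∃ N ∈ C.lower, ∃ c' : ℕ, c' < c ∧ N = Function.update P g (lineLetter h c' k) := by
  have hjg : g ≠ g + 1 := (add_one_ne g).symm
  obtain ⟨cj, kj, -, hj⟩ := hPL (g + 1)
  have had1 : Adapted (P g) (k + 2) := by rw [hg]; exact (adapted_lineLetter h c k).2
  have had2 : Adapted (P (g + 1)) kj := by rw [hj]; exact (adapted_lineLetter h cj kj).1
  have hne : coord (P g) (k + 2) ≠ coord (P (g + 1)) kj := by
    rw [hg, hj, (coord_lineLetter h c k).2, (coord_lineLetter h cj kj).1]
    have : (1 : ℤ) ≤ c := by exact_mod_cast hc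
    omega
  rcases hD g (g + 1) hjg (k + 2) kj had1 had2 hne with h1 | h2 | h3
  · obtain ⟨r, -, N, hN, hagree, hlt, hray⟩ := h1
    obtain ⟨c', k', -, hNg⟩ := hlow N hN g
    rw [hNg, hg] at hray hlt
    rw [lineLetter_fst, lineLetter_fst] at hlt
    have hd : (1 : ℤ) ≤ (lineLetter h c' k').1 - (lineLetter h c k).1 := by
      rw [lineLetter_fst, lineLetter_fst]; omega
    obtain ⟨-, -, hk⟩ := up_classify hd hray
    refine ⟨N, hN, c', by omega, ?_⟩
    funext f
    by_cases hf : f = g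
    · subst hf
      rw [Function.update_self, hNg]
      rcases hk with h0 | hk
      · subst h0; rw [lineLetter_zero, lineLetter_zero]
      · rw [hk]
    · rw [Function.update_of_ne hf]; exact (hagree f hf).symm
  · obtain ⟨r, hr, N, hN, -, hlt, hray⟩ := h2
    obtain ⟨c', k', -, hNj⟩ := hlow N hN (g + 1)
    rw [hNj, hj] at hray hlt
    have hd : (1 : ℤ) ≤ (lineLetter h c' k').1 - (lineLetter h cj kj).1 := by
      rw [lineLetter_fst, lineLetter_fst] at hlt ⊢; omega
    obtain ⟨hrk, -, -⟩ := up_classify hd hray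
    exact absurd hrk hr
  · obtain ⟨a, b, -, hb, N, hN, -, -, -, hlt, hray⟩ := h3
    obtain ⟨c', k', -, hNj⟩ := hlow N hN (g + 1)
    rw [hNj, hj] at hray hlt
    have hd : (1 : ℤ) ≤ (lineLetter h c' k').1 - (lineLetter h cj kj).1 := by
      rw [lineLetter_fst, lineLetter_fst] at hlt ⊢; omega
    obtain ⟨hbk, -, -⟩ := up_classify hd hray
    rcases hb with hb | ⟨-, hb⟩
    · exact (add_two_ne kj (hbk ▸ hb)).elim
    · exact (hb hbk).elim

/-- **(RD-N≥2) a RULE-D `N`-cell with two charged letters is served below along each of their own rays**: if `Z g = (c, k)` and `Z j`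
are charged (`g ≠ j`), some present `P`-cell is `Z(g ↦ (c′, k))` with `c < c′` (and `2c′ ≤ h`). In particular (T1): `2c = h` is impossible. -/
theorem n_down_server {h : ℤ} {C : MConfig} (hup : ∀ P ∈ C.upper, ∀ f, IsLL h (P f)) {Z : MCell}
    (hD : RuleDMu4N C Z) {g j : Fin 4} (hgj : g ≠ j) {c cj : ℕ} {k kj : Fin 4}
    (hg : Z g = lineLetter h c k) (hc : 1 ≤ c) (hj : Z j = lineLetter h cj kj) (hcj : 1 ≤ cj) :
    ∃ P ∈ C.upper, ∃ c' : ℕ, c < c' ∧ 2 * (c' : ℤ) ≤ h ∧ P = Function.update Z g (lineLetter h c' k) := by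
  have had1 : Adapted (Z g) (k + 2) := by rw [hg]; exact (adapted_lineLetter h c k).2
  have had2 : Adapted (Z j) kj := by rw [hj]; exact (adapted_lineLetter h cj kj).1
  have hne : coord (Z g) (k + 2) ≠ coord (Z j) kj := by
    rw [hg, hj, (coord_lineLetter h c k).2, (coord_lineLetter h cj kj).1]
    have : (1 : ℤ) ≤ c := by exact_mod_cast hc
    omega
  rcases hD g j hgj (k + 2) kj had1 had2 hne with h1 | h2 | h3
  · obtain ⟨r, -, P, hP, hagree, hlt, hray⟩ := h1
    obtain ⟨c', k', hb, hPg⟩ := hup P hP g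
    rw [hPg, hg] at hray hlt
    have hd : (1 : ℤ) ≤ (lineLetter h c k).1 - (lineLetter h c' k').1 := by
      rw [lineLetter_fst, lineLetter_fst] at hlt ⊢; omega
    obtain ⟨-, -, hk⟩ := up_classify hd hray
    rw [lineLetter_fst, lineLetter_fst] at hlt
    refine ⟨P, hP, c', by omega, hb, ?_⟩
    funext f
    by_cases hf : f = g
    · subst hf
      rw [Function.update_self, hPg]
      rcases hk with h0 | hk
      · omega
      · rw [hk]
    · rw [Function.update_of_ne hf]; exact hagree f hf
  · obtain ⟨r, hr, P, hP, -, hlt, hray⟩ := h2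
    obtain ⟨c', k', -, hPj⟩ := hup P hP j
    rw [hPj, hj] at hray hlt
    have hd : (1 : ℤ) ≤ (lineLetter h cj kj).1 - (lineLetter h c' k').1 := by
      rw [lineLetter_fst, lineLetter_fst] at hlt ⊢; omega
    obtain ⟨hrk, -, hk⟩ := up_classify hd hray
    rcases hk with h0 | hk
    · omega
    · exact (hr (hk ▸ hrk)).elim
  · obtain ⟨a, b, -, hb, P, hP, -, -, -, hlt, hray⟩ := h3
    obtain ⟨c', k', -, hPj⟩ := hup P hP j
    rw [hPj, hj] at hray hlt
    have hd : (1 : ℤ) ≤ (lineLetter h cj kj).1 - (lineLetter h c' k').1 := by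
      rw [lineLetter_fst, lineLetter_fst] at hlt ⊢; omega
    obtain ⟨hbk, -, hk⟩ := up_classify hd hray
    have hkk : kj = k' := by
      rcases hk with h0 | hk
      · omega
      · exact hk
    subst hkk
    rcases hb with hb | ⟨-, hb⟩
    · exact (add_two_ne kj (hbk ▸ hb)).elim
    · exact (hb hbk).elim

/-- **(RD-N1) a RULE-D `N`-cell with a charged letter `(c, k)` on `g` and an apex letter on `j`**, for every direction `k′`: either it is
served below along the own ray of `g`, or some present `P`-cell is `Z(j ↦ (d, p))` with `d ≥ 1` and phase `p ≠ k′`, or some present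
`P`-cell is the cover `Z(g ↦ (c′, k), j ↦ (d, p))`, `c < c′`, `d ≥ 1`, `p ≠ k′`. -/
theorem n_hub_alternative {h : ℤ} {C : MConfig} (hup : ∀ P ∈ C.upper, ∀ f, IsLL h (P f)) {Z : MCell} (hZL : ∀ f, IsLL h (Z f))
    (hD : RuleDMu4N C Z) {g j : Fin 4} (hgj : g ≠ j) {c : ℕ} {k : Fin 4}
    (hg : Z g = lineLetter h c k) (hc : 1 ≤ c) (hja : isApex (Z j)) (k' : Fin 4) :
    (∃ P ∈ C.upper, ∃ c' : ℕ, c < c' ∧ 2 * (c' : ℤ) ≤ h ∧ P = Function.update Z g (lineLetter h c' k)) ∨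
    (∃ P ∈ C.upper, ∃ d : ℕ, ∃ p : Fin 4, 1 ≤ d ∧ p ≠ k' ∧ P = Function.update Z j (lineLetter h d p)) ∨
    (∃ P ∈ C.upper, ∃ c' d : ℕ, ∃ p : Fin 4, c < c' ∧ 2 * (c' : ℤ) ≤ h ∧ 1 ≤ d ∧ p ≠ k' ∧
        P = Function.update (Function.update Z g (lineLetter h c' k)) j (lineLetter h d p)) := by
  obtain ⟨cj, kj, -, hj⟩ := hZL j
  have hcj : cj = 0 := (isApex_lineLetter_iff h cj kj).1 (hj ▸ hja)
  subst hcj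
  have had1 : Adapted (Z g) (k + 2) := by rw [hg]; exact (adapted_lineLetter h c k).2
  have had2 : Adapted (Z j) k' := by rw [hj, lineLetter_zero]; fin_cases k' <;> simp [Adapted]
  have hne : coord (Z g) (k + 2) ≠ coord (Z j) k' := by
    rw [hg, hj, (coord_lineLetter h c k).2, lineLetter_zero]
    have : (1 : ℤ) ≤ c := by exact_mod_cast hc
    have hco : coord ((h, 0, 0) : BPoint) k' = h := by fin_cases k' <;> simp [coord]
    rw [hco]; omega
  rcases hD g j hgj (k + 2) k' had1 had2 hne with h1 | h2 | h3
  · left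
    obtain ⟨r, -, P, hP, hagree, hlt, hray⟩ := h1
    obtain ⟨c', k'', hb, hPg⟩ := hup P hP g
    rw [hPg, hg] at hray hlt
    have hd : (1 : ℤ) ≤ (lineLetter h c k).1 - (lineLetter h c' k'').1 := by
      rw [lineLetter_fst, lineLetter_fst] at hlt ⊢; omega
    obtain ⟨-, -, hk⟩ := up_classify hd hray
    rw [lineLetter_fst, lineLetter_fst] at hlt
    refine ⟨P, hP, c', by omega, hb, ?_⟩
    funext f
    by_cases hf : f = g
    · subst hf
      rw [Function.update_self, hPg]
      rcases hk with h0 | hk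
      · omega
      · rw [hk]
    · rw [Function.update_of_ne hf]; exact hagree f hf
  · right; left
    obtain ⟨r, hr, P, hP, hagree, hlt, hray⟩ := h2
    obtain ⟨c', k'', -, hPj⟩ := hup P hP j
    rw [hPj, hj] at hray hlt
    have hd : (1 : ℤ) ≤ (lineLetter h 0 kj).1 - (lineLetter h c' k'').1 := by
      rw [lineLetter_fst, lineLetter_fst] at hlt ⊢; omega
    obtain ⟨hrk, hcc, -⟩ := up_classify hd hray
    rw [lineLetter_fst, lineLetter_fst] at hlt
    refine ⟨P, hP, c', k'', by omega, ?_, ?_⟩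
    · rintro rfl; exact hr hrk
    · funext f
      by_cases hf : f = j
      · subst hf; rw [Function.update_self, hPj]
      · rw [Function.update_of_ne hf]; exact hagree f hf
  · right; right
    obtain ⟨a, b, -, hb, P, hP, hag2, hltg, hrayg, hltj, hrayj⟩ := h3
    obtain ⟨c', kg, hbd, hPg⟩ := hup P hP g
    obtain ⟨d, p, -, hPj⟩ := hup P hP j
    rw [hPg, hg] at hrayg hltg
    rw [hPj, hj] at hrayj hltj
    have hdg : (1 : ℤ) ≤ (lineLetter h c k).1 - (lineLetter h c' kg).1 := by
      rw [lineLetter_fst, lineLetter_fst] at hltg ⊢; omega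
    have hdj : (1 : ℤ) ≤ (lineLetter h 0 kj).1 - (lineLetter h d p).1 := by
      rw [lineLetter_fst, lineLetter_fst] at hltj ⊢; omega
    obtain ⟨-, -, hk⟩ := up_classify hdg hrayg
    obtain ⟨hbp, -, -⟩ := up_classify hdj hrayj
    rw [lineLetter_fst, lineLetter_fst] at hltg hltj
    have hkk : k = kg := by
      rcases hk with h0 | hk
      · omega
      · exact hk
    subst hkk
    refine ⟨P, hP, c', d, p, by omega, hbd, by omega, ?_, ?_⟩
    · rintro rfl
      rcases hb with hb | ⟨-, hb⟩
      · exact add_two_ne p (hbp ▸ hb)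
      · exact hb hbp
    · funext f
      by_cases hfj : f = j
      · subst hfj; rw [Function.update_self, hPj]
      · rw [Function.update_of_ne hfj]
        by_cases hfg : f = g
        · subst hfg; rw [Function.update_self, hPg]
        · rw [Function.update_of_ne hfg]; exact hag2 f hfg hfj

end Summit.Ventures.HSemireg.Pad4Tower.LineInertia
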